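import Mathlib
import HarnessLib
import Summits.NavierStokesRegularity.NavierStokesRegularity.Theses.IsobarTomography
import Literature.Analysis.FluidPDE.NSBoundedMildAnalytic
import Literature.Analysis.FluidPDE.AncientMildCompactness
import Summits.NavierStokesRegularity.NavierStokesRegularity.Theorems.IsobarTomographyTubeAlternativeStubOseenAncientAnalytic
import Summits.NavierStokesRegularity.NavierStokesRegularity.Theorems.IsobarTomographyTubeAlternativeStubDefectAnalyticOfVelocity
import Summits.NavierStokesRegularity.NavierStokesRegularity.Theorems.IsobarTomographyTubeAlternativeStubTwoSidedVorticityRate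
import Summits.NavierStokesRegularity.NavierStokesRegularity.Theorems.IsobarTomographyTubeAlternativeStubPeakZoomPatch
import Summits.NavierStokesRegularity.NavierStokesRegularity.Theorems.IsobarTomographyTubeAlternativeStubAntiBlobPeaks
import Summits.NavierStokesRegularity.NavierStokesRegularity.Theorems.IsobarTomographyTubeAlternativeReduction
import Summits.NavierStokesRegularity.NavierStokesRegularity.Theorems.LiouvilleConjectureNS
import Summits.NavierStokesRegularity.NavierStokesRegularity.Theorems.SqueezeCycleSingularZoom
import Summits.NavierStokesRegularity.NavierStokesRegularity.Theorems.SqueezeCycleExtremalBiaxialitySubcriticalOfLiouville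

/-!
# Line `analytic-propagation-local-patch` for crux `IsobarTomography.TubeAlternative`
# (stmt-NavierStokesRegularity-11739) — lead prover's registered skeleton (lead a1, cycle 1; continued by lead c1, cycle 2; lead c2, cycle 3)

Lead c2 (2026-08-16, continuation after c1): skeleton taken over UNCHANGED again (same six stub names and
registered signatures, same composition `TubeAlternative_of`); the only open stub is still the bet 5b, held
by the lead; wave: none (1 stub left). Cycle-3 work: the UNCONDITIONAL calibration of the crux — its u-free
conclusion C is equivalent to `¬ IsobaricLinesLiouville` (sup-normalising rescaling of a K2-counterexample),
hence `TubeAlternative ↔ (IsobarTomography.IsobaricLinesLiouville → TypeIForcesBlob)` with no K1/K2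
hypothesis, see `Theorems/IsobarTomographyTubeAlternativeLiouvilleGauge.lean`.

Lead c1 (2026-08-16, continuation after a1's `promote-stub`): skeleton taken over UNCHANGED (same six stub
names and registered signatures, same composition); the only open stub is the bet 5b, held by the lead;
wave: none (1 stub left). Cycle-2 work: calibration of the bet against the tree's existing open items
(Type-I zoom WITHOUT the action hypothesis ⇒ non-slice-constant KNSS limit; hence
`TypeIliouvilleL → TubeAlternative`), see `Theorems/IsobarTomographyTubeAlternativeZoomCalibration.lean`.

Source line: planner `crux-plan r1` skeleton `line-analytic-propagation-local-patch.lean`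
(evidence 20260816T135518Z, sha 7658ba3d2d40; four stubs `stub_twoSidedVorticityRate` (L),
`stub_peakZoomPatch` (XL), `stub_oseenAncientDefectAnalytic` (M), `stub_peakActionDecay` (bet)),
card `Cruxes/TubeAlternative/Ideas/analytic-propagation-local-patch.md`, first lemmas in
`Cruxes/TubeAlternative/SketchIdeator1.lean`. The planner's file itself is not readable from the lead's
jail (crux write was refused for that seat; `run/gate/evidence` is not mounted), so the skeleton is
REBUILT here from the registered stub signatures (`ledger workitem get … stubs`) and the ideator's
definitions, with ONE reshape:

* the planner's `stub_oseenAncientDefectAnalytic` (Oseen-ancient bounded classical `(w,q)` ⇒ the defect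
  `⟪curl w, ∇q⟫` is jointly real-analytic on the slab) is split into the two provable-now stubs
  `stub_oseenAncientAnalytic` (the VELOCITY of a bounded continuous Oseen-ancient field is jointly
  analytic — `lemarieRieusset2016_local_analyticity_holds` restarted at every `s < 0` +
  `oseenMild_essBounded_unique`) and `stub_defectAnalyticOfVelocity` (analytic velocity + classical
  momentum equation ⇒ analytic `∇q = Δw − ∂ₜw − (w·∇)w`, hence analytic defect);
* every stub is stated in TREE VOCABULARY ONLY (the line's three definitions `isobaricDefect`,
  `isobaricAction`, `IsOseenAncient` are unfolded inside the `stub_*` signatures), so that each stub can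
  be landed as a self-contained `Theorems/IsobarTomographyTubeAlternative<Stub>.lean` file.

## Stubs (6 + the named reduction; after cycle 1 only 5b is open — ONE sorry below)

* `stub_twoSidedVorticityRate` (L; worker) — Type-I ⇒ `c/(T−t) ≤ ‖ω(t)‖_∞ ≤ C/(T−t)` near `T`.
* `stub_peakZoomPatch` (XL; worker) — the vorticity-scale zoom at near-maximal peaks with vanishing
  isobaric action yields an Oseen-ancient KNSS limit with classical pressure, not slice-constant, whose
  defect vanishes on an open space–time patch.
* `stub_oseenAncientAnalytic` (M; worker) — bounded continuous Oseen-ancient fields are jointly analytic.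
* `stub_defectAnalyticOfVelocity` (M; worker) — analytic velocity + classical pressure ⇒ analytic defect.
* `stub_antiBlobPeaks` (S; lead) — `¬ blob` tested with `Ω = θ·sup|ω|`: anti-blob near-max peaks for every `κ`, `θ`.
* `stub_peakActionDecayOfAntiBlobPeaks` (THE BET, HARDEST; lead) — anti-blob peaks ⇒ late near-max peaks of
  small isobaric action (cycle-1 reshape of the planner's `stub_peakActionDecay` = 5b ∘ 5a).

`TubeAlternative_of : Theses.IsobarTomography.TubeAlternative` composes them (sorry-free modulo the bet; the same
composition with the bet as hypothesis is landed as `stub_tubeAlternativeOfPeakActionDecay`, p119816): rates (1),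
anti-blob peaks (5a) and the bet (5b) give peaks of action `< 1/(k+1)` at times `≥ T − 1/(k+1)`, which feed the zoom (2); the limit's velocity is
analytic (3), so is its defect (4); the identity theorem on the preconnected slab `(-∞,0) × ℝ³` spreads
the open isobaric patch to the whole slab.

Disproof honoured: none exists for this crux at registration time (payload `disproof_path` absent from the
jail; `ledger crux ls`: no `Disproof.lean`), 2026-08-16.
-/

set_option linter.dupNamespace false

noncomputable section

namespace Summit.NavierStokesRegularity.NavierStokesRegularity.Cruxes.TubeAlternative.AnalyticPropagation

open Set Filter Topology Function MeasureTheory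
open scoped RealInnerProductSpace
open Literature.Analysis.FluidPDE
open Summit.NavierStokesRegularity.NavierStokesRegularity.Theses.IsobarTomography

/-- Physical space. -/
local notation "E3" => EuclideanSpace ℝ (Fin 3)

/-! ## The line's three objects (unfolded everywhere below; recorded here for the reader)

* isobaric DEFECT `F(t, x) = ⟪curl v(t) x, ∇q(t) x⟫ = |ω| ∂_ξ q` (a space–time pseudoscalar);
* isobaric ACTION `𝒜_ν(u,p)(t,x) = ν⁻² ∫_{(t−1/|ω(t,x)|, t) × B(x, √(ν/|ω(t,x)|))} |⟪curl u, ∇p⟫|`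
  (ideator 1, `SketchIdeator1.isobaricAction`; scale-free);
* OSEEN-ANCIENT field: `v(t) x = heatExtension (v s) (t − s) x − oseenDuhamel 1 s v v t x` for all
  `s < t < 0` and all `x` (the drift-free mild class of KNSS 2009 §4 in the tree's rendering,
  `AncientMildCompactness` / `NSBoundedMildOseen`). -/

/-! ## Registered stubs -/

/-- **Stub 1 (`twoSidedVorticityRate`, size L).** At a Type-I singular time of a maximal Leray–Hopf
classical solution from a rapidly decaying datum the vorticity maximum obeys a TWO-SIDED Type-I law
`c/(T−t) ≤ ‖ω(t)‖_∞ ≤ C/(T−t)` for `t` near `T` (upper: parabolic smoothing under the Type-I velocity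
bound; lower: a slice with `(T−t)‖ω(t)‖_∞ → 0` has, at the Type-I scale, bounded velocity and vanishing
gradient, and such data do not blow up within unit time). Registered signature of the planner, verbatim. -/
theorem stub_twoSidedVorticityRate :
    ∀ (ν T : ℝ), 0 < ν → 0 < T → ∀ (u : ℝ → E3 → E3) (p : ℝ → E3 → ℝ),
    IsMaximalSmoothSolution ν 0 u p T → IsLerayHopfOn T ν 0 (u 0) u →
    HasRapidSpatialDecay (u 0) → IsTypeIBlowup u T →
    ∃ c C : ℝ, 0 < c ∧ ∃ t₁ ∈ Set.Ico 0 T, ∀ t ∈ Set.Ico t₁ T,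
      (∃ x : E3, c / (T - t) ≤ ‖curl (u t) x‖) ∧ ∀ x : E3, ‖curl (u t) x‖ ≤ C / (T - t) :=
  _root_.Summit.NavierStokesRegularity.NavierStokesRegularity.Theorems.TubeAlternative.AnalyticPropagation.stub_twoSidedVorticityRate

/-- **Stub 2 (`peakZoomPatch`, size XL).** KNSS/Albritton–Barker bookkeeping of the zoom at the
vorticity scale: given the two-sided rate data `(c, C, t₁)`, a sequence of `θ`-near-maximal vorticity
peaks `(t_k, x_k)`, `t_k → T`, along which the isobaric action tends to `0`, produces a KNSS blow-up
limit `v` with classical pressure `q` on `(-∞,0)` which is OSEEN-ancient (drift-free), not slice-wise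
constant (the peak vorticity survives the zoom), and whose isobaric defect `⟪curl v, ∇q⟫` vanishes on a
non-empty open space–time patch (the limit of the unit cylinders of vanishing action). Planner's
registered signature with the line's definitions unfolded. -/
theorem stub_peakZoomPatch :
    ∀ (ν T : ℝ), 0 < ν → 0 < T → ∀ (u : ℝ → E3 → E3) (p : ℝ → E3 → ℝ),
    IsMaximalSmoothSolution ν 0 u p T → IsLerayHopfOn T ν 0 (u 0) u →
    HasRapidSpatialDecay (u 0) → IsTypeIBlowup u T →
    ∀ (c C t₁ : ℝ), 0 < c → t₁ ∈ Set.Ico 0 T →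
    (∀ t ∈ Set.Ico t₁ T, (∃ x : E3, c / (T - t) ≤ ‖curl (u t) x‖) ∧
      ∀ x : E3, ‖curl (u t) x‖ ≤ C / (T - t)) →
    ∀ θ : ℝ, 0 < θ → θ < 1 → ∀ (tk : ℕ → ℝ) (xk : ℕ → E3), (∀ k, tk k ∈ Set.Ico t₁ T) →
    Tendsto tk atTop (𝓝 T) → (∀ k, 0 < ‖curl (u (tk k)) (xk k)‖) →
    (∀ k, ∀ y : E3, θ * ‖curl (u (tk k)) y‖ ≤ ‖curl (u (tk k)) (xk k)‖) →
    Tendsto (fun k => ν⁻¹ ^ 2 *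
      ∫ z in (Set.Ioo (tk k - 1 / ‖curl (u (tk k)) (xk k)‖) (tk k)) ×ˢ
        Metric.ball (xk k) (Real.sqrt (ν / ‖curl (u (tk k)) (xk k)‖)),
        |⟪curl (u z.1) z.2, gradient (p z.1) z.2⟫|) atTop (𝓝 0) →
    ∃ (v : ℝ → E3 → E3) (q : ℝ → E3 → ℝ), IsKNSSBlowupLimit v ∧
      IsClassicalNSSolutionOn (Set.Iio 0) 1 0 v q ∧
      (∀ s t : ℝ, s < t → t < 0 → ∀ x : E3,
        v t x = Literature.Analysis.UnboundedOperators.heatExtension (v s) (t - s) x -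
          oseenDuhamel 1 s v v t x) ∧
      ¬ (∀ t < 0, ∃ b : E3, v t = fun _ => b) ∧
      ∃ U : Set (ℝ × E3), IsOpen U ∧ U.Nonempty ∧ U ⊆ Set.Iio 0 ×ˢ Set.univ ∧
        ∀ z ∈ U, ⟪curl (v z.1) z.2, gradient (q z.1) z.2⟫ = 0 :=
  _root_.Summit.NavierStokesRegularity.NavierStokesRegularity.Theorems.TubeAlternative.AnalyticPropagation.stub_peakZoomPatch

/-- **Stub 3 (`oseenAncientAnalytic`, size M, provable now).** A field `w`, continuous and bounded on
the open slab `(-∞,0) × ℝ³` and satisfying the Oseen integral identity between all pairs of negative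
times, is jointly real-analytic on the slab. Source: `lemarieRieusset2016_local_analyticity_holds`
(PROVED: the Oseen fixed point from a datum bounded by `M` is `AnalyticOnNhd ℝ` jointly on the window
`(s, s + ε/M²) × ℝ³`), restarted at every `s < 0` with the same bound, the windows covering the slab;
`oseenMild_essBounded_unique` (PROVED) identifies the analytic fixed point with `w` a.e. on each slice,
hence everywhere by continuity. -/
theorem stub_oseenAncientAnalytic :
    ∀ (w : ℝ → E3 → E3), ContinuousOn (uncurry w) (Set.Iio 0 ×ˢ Set.univ) →
    (∃ M : ℝ, ∀ t < 0, ∀ x : E3, ‖w t x‖ ≤ M) →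
    (∀ s t : ℝ, s < t → t < 0 → ∀ x : E3,
      w t x = Literature.Analysis.UnboundedOperators.heatExtension (w s) (t - s) x -
        oseenDuhamel 1 s w w t x) →
    AnalyticOnNhd ℝ (uncurry w) (Set.Iio 0 ×ˢ Set.univ) :=
  _root_.Summit.NavierStokesRegularity.NavierStokesRegularity.Theorems.TubeAlternative.AnalyticPropagation.stub_oseenAncientAnalytic

/-- **Stub 4 (`defectAnalyticOfVelocity`, size M, provable now).** If the velocity `w` is jointly
real-analytic on the open slab and `(w, q)` is a classical Navier–Stokes solution there (`ν = 1`, no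
force), then the isobaric defect `(t,x) ↦ ⟪curl w(t) x, ∇q(t) x⟫` is jointly real-analytic on the slab:
by the momentum equation `∇q = Δw − ∂ₜw − (w·∇)w` on the open time set `(-∞,0)` (where the one-sided
time derivative is the two-sided one), and derivatives, evaluations and products of analytic maps are
analytic (Mathlib `AnalyticOnNhd.fderiv`, `AnalyticAt.clm_apply`, `AnalyticAt.mul`). -/
theorem stub_defectAnalyticOfVelocity :
    ∀ (w : ℝ → E3 → E3) (q : ℝ → E3 → ℝ),
    AnalyticOnNhd ℝ (uncurry w) (Set.Iio 0 ×ˢ Set.univ) →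
    IsClassicalNSSolutionOn (Set.Iio 0) 1 0 w q →
    AnalyticOnNhd ℝ (fun z : ℝ × E3 => ⟪curl (w z.1) z.2, gradient (q z.1) z.2⟫)
      (Set.Iio 0 ×ˢ Set.univ) :=
  _root_.Summit.NavierStokesRegularity.NavierStokesRegularity.Theorems.TubeAlternative.AnalyticPropagation.stub_defectAnalyticOfVelocity

/-- **Stub 5a (`antiBlobPeaks`, size S, LANDED p119558 — what `¬ blob` actually delivers).** Tested
with the threshold `Ω(t) = θ · sup_x ‖ω(t,x)‖` (finite and positive for late `t` by stub 1), the failed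
blob hypothesis says: for every `κ > 0`, `θ ∈ (0,1)`, `t₀ < T` there are a later time `t` and a
`θ`-near-maximal vorticity point `x` with `D²p[ω,ω](t,x) < κ‖ω(t,x)‖²Δp(t,x)` (an ANTI-BLOB PEAK). -/
theorem stub_antiBlobPeaks :
    ∀ (ν T : ℝ), 0 < ν → 0 < T → ∀ (u : ℝ → E3 → E3) (p : ℝ → E3 → ℝ),
    IsMaximalSmoothSolution ν 0 u p T → IsLerayHopfOn T ν 0 (u 0) u →
    HasRapidSpatialDecay (u 0) → IsTypeIBlowup u T →
    (¬ ∃ κ : ℝ, 0 < κ ∧ ∃ Ω : ℝ → ℝ, ∃ t₀ ∈ Set.Ico 0 T, ∀ t ∈ Set.Ico t₀ T,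
      (∃ x : E3, Ω t < ‖curl (u t) x‖) ∧ ∀ x : E3, Ω t < ‖curl (u t) x‖ →
        κ * ‖curl (u t) x‖ ^ 2 * Laplacian.laplacian (p t) x ≤
          iteratedFDeriv ℝ 2 (p t) x ![curl (u t) x, curl (u t) x]) →
    ∀ κ θ : ℝ, 0 < κ → 0 < θ → θ < 1 → ∀ t₀ ∈ Set.Ico 0 T, ∃ t ∈ Set.Ico t₀ T, ∃ x : E3,
      0 < ‖curl (u t) x‖ ∧ (∀ y : E3, θ * ‖curl (u t) y‖ ≤ ‖curl (u t) x‖) ∧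
      iteratedFDeriv ℝ 2 (p t) x ![curl (u t) x, curl (u t) x] <
        κ * ‖curl (u t) x‖ ^ 2 * Laplacian.laplacian (p t) x :=
  _root_.Summit.NavierStokesRegularity.NavierStokesRegularity.Theorems.TubeAlternative.AnalyticPropagation.stub_antiBlobPeaks

/-- **Stub 5b (`peakActionDecayOfAntiBlobPeaks`, THE BET, HARDEST — the lead's).** At a Type-I singular
time with anti-blob peaks for every `κ > 0` and `θ < 1` (the conclusion of stub 5a), the isobaric action at
the near-maximal vorticity peaks is NOT bounded away from zero: for every `η > 0`, `θ ∈ (0,1)` and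
`t₁ < T` there is a later time `t ∈ [t₁, T)` and a `θ`-near-maximal vorticity point `x` with action `< η`.
This is the crux's content in this line: with stubs 1–4 and 5a landed, `TubeAlternative` follows from it
(`tubeAlternative_of_peakActionDecayOfAntiBlobPeaks` below, sorry-free), and granted the route's K2 it is
equivalent to "Type-I ∧ ¬blob is impossible" (p101533). -/
theorem stub_peakActionDecayOfAntiBlobPeaks :
    ∀ (ν T : ℝ), 0 < ν → 0 < T → ∀ (u : ℝ → E3 → E3) (p : ℝ → E3 → ℝ),
    IsMaximalSmoothSolution ν 0 u p T → IsLerayHopfOn T ν 0 (u 0) u →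
    HasRapidSpatialDecay (u 0) → IsTypeIBlowup u T →
    (∀ κ θ : ℝ, 0 < κ → 0 < θ → θ < 1 → ∀ t₀ ∈ Set.Ico 0 T, ∃ t ∈ Set.Ico t₀ T, ∃ x : E3,
      0 < ‖curl (u t) x‖ ∧ (∀ y : E3, θ * ‖curl (u t) y‖ ≤ ‖curl (u t) x‖) ∧
      iteratedFDeriv ℝ 2 (p t) x ![curl (u t) x, curl (u t) x] <
        κ * ‖curl (u t) x‖ ^ 2 * Laplacian.laplacian (p t) x) →
    ∀ η θ : ℝ, 0 < η → 0 < θ → θ < 1 → ∀ t₁ ∈ Set.Ico 0 T, ∃ t ∈ Set.Ico t₁ T, ∃ x : E3,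
      0 < ‖curl (u t) x‖ ∧ (∀ y : E3, θ * ‖curl (u t) y‖ ≤ ‖curl (u t) x‖) ∧
      ν⁻¹ ^ 2 * (∫ z in (Set.Ioo (t - 1 / ‖curl (u t) x‖) t) ×ˢ
          Metric.ball x (Real.sqrt (ν / ‖curl (u t) x‖)),
          |⟪curl (u z.1) z.2, gradient (p z.1) z.2⟫|) < η := by
  sorry

/-! ## Calibration stubs (lead c1, cycle 2 — LANDED p121485 / p121573; census only, not used by `TubeAlternative_of`)

The bet 5b and the crux are calibrated against the tree's existing open items in
`Theorems/IsobarTomographyTubeAlternativeCalibration.lean` (namespace `…Theorems.TubeAlternative`):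
`NoTypeIBlowup` (stmt-1217) ⟹ 5b ⟹ D, and granted the route's K1 ∧ K2, D ⟺ `NoTypeIBlowup`; above it
`NoSingularTypeIModel` (stmt-10569) ⟸ `SqueezeLiouville` (stmt-11608) ⟸ `LiouvilleConjectureNS` (stmt-10661)
all imply D through the PROVED shared `SingularZoom`. The proofs are repeated here inline (short) so that this
workfile elaborates without importing the calibration module. -/

/-- Liouville on `𝒦_C` ⟹ no singular Type-I model (a field vanishing on `t < 0` is bounded at the origin). -/
theorem noSingularTypeIModel_of_squeezeLiouville
    (hL : Summit.NavierStokesRegularity.NavierStokesRegularity.Theses.SqueezeCycle.SqueezeLiouville) :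
    Summit.NavierStokesRegularity.NavierStokesRegularity.Theses.ClockStretchingLaw.NoSingularTypeIModel := by
  intro C v hv hsing
  obtain ⟨t, ht, x, -, hlt⟩ := hsing 1 one_pos 0
  have h0 : v t x = 0 := hL C v hv t ht.2 x
  rw [h0, norm_zero] at hlt
  exact lt_irrefl _ hlt

/-- **Calibration stub A (registered `stub_calibrationTools`, LANDED p121485).** (L) ⟹ D; `SqueezeLiouville` ⟹ D;
`NoSingularTypeIModel` ⟹ D; granted K1 ∧ K2, D ⟺ Type-I extension. -/
theorem stub_calibrationTools :
    (Summit.NavierStokesRegularity.NavierStokesRegularity.LiouvilleConjectureNS →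
      Summit.NavierStokesRegularity.NavierStokesRegularity.Theses.IsobarTomography.TubeAlternative) ∧
    (Summit.NavierStokesRegularity.NavierStokesRegularity.Theses.SqueezeCycle.SqueezeLiouville →
      Summit.NavierStokesRegularity.NavierStokesRegularity.Theses.IsobarTomography.TubeAlternative) ∧
    (Summit.NavierStokesRegularity.NavierStokesRegularity.Theses.ClockStretchingLaw.NoSingularTypeIModel →
      Summit.NavierStokesRegularity.NavierStokesRegularity.Theses.IsobarTomography.TubeAlternative) ∧
    (Summit.NavierStokesRegularity.NavierStokesRegularity.Theses.IsobarTomography.BlobRiccatiClosure →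
      Summit.NavierStokesRegularity.NavierStokesRegularity.Theses.IsobarTomography.IsobaricLinesLiouville →
      (Summit.NavierStokesRegularity.NavierStokesRegularity.Theses.IsobarTomography.TubeAlternative ↔
        ∀ (ν T : ℝ), 0 < ν → 0 < T →
        ∀ (u : ℝ → EuclideanSpace ℝ (Fin 3) → EuclideanSpace ℝ (Fin 3))
          (p : ℝ → EuclideanSpace ℝ (Fin 3) → ℝ),
        Literature.Analysis.FluidPDE.IsClassicalNSSolutionOn (Set.Ico 0 T) ν 0 u p →
        Literature.Analysis.FluidPDE.IsLerayHopfOn T ν 0 (u 0) u →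
        Literature.Analysis.FluidPDE.HasRapidSpatialDecay (u 0) →
        Literature.Analysis.FluidPDE.IsTypeIBlowup u T →
        Literature.Analysis.FluidPDE.HasSmoothExtensionPast ν 0 u T)) :=
  by
  -- Type-I extension (= `NoTypeIBlowup`, stmt-1217) ⟹ D: the antecedent of D is void
  have hofExt : Summit.NavierStokesRegularity.NavierStokesRegularity.Theses.TypeICertificateLadder.NoTypeIBlowup →
      TubeAlternative := fun hext ν T hν hT u p hmax hLH hdec hI _ =>
    absurd (hext ν T hν hT u p hmax.1 hLH hdec hI) hmax.2
  -- granted K1 ∧ K2, D ⟹ Type-I extension (the tube/blob split of the route's `closes`)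
  have hextOf : TubeAlternative → BlobRiccatiClosure → IsobaricLinesLiouville →
      Summit.NavierStokesRegularity.NavierStokesRegularity.Theses.TypeICertificateLadder.NoTypeIBlowup := by
    intro hD hB hL ν T hν hT u p hcl hLH hdec hI
    by_contra hext
    by_cases hblob : ∃ κ : ℝ, 0 < κ ∧ ∃ Ω : ℝ → ℝ, ∃ t₀ ∈ Set.Ico 0 T, ∀ t ∈ Set.Ico t₀ T,
        (∃ x : E3, Ω t < ‖curl (u t) x‖) ∧ ∀ x : E3, Ω t < ‖curl (u t) x‖ →
          κ * ‖curl (u t) x‖ ^ 2 * Laplacian.laplacian (p t) x ≤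
            iteratedFDeriv ℝ 2 (p t) x ![curl (u t) x, curl (u t) x]
    · exact hext (hB ν T hν hT u p hcl hLH hdec hblob)
    · obtain ⟨v, q, hv, hvq, hcol, hnc⟩ := hD ν T hν hT u p ⟨hcl, hext⟩ hLH hdec hI hblob
      exact hnc (hL v q hv.isBoundedAncientMildSolution hvq hcol)
  exact ⟨fun hL => hofExt (Theorems.clockStretchingLaw_singularZoom_proof
      (noSingularTypeIModel_of_squeezeLiouville (Theorems.squeezeLiouville_of_liouvilleConjectureNS hL))),
    fun hS => hofExt (Theorems.clockStretchingLaw_singularZoom_proof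
      (noSingularTypeIModel_of_squeezeLiouville hS)),
    fun hX => hofExt (Theorems.clockStretchingLaw_singularZoom_proof hX),
    fun hB hL => ⟨fun hD => hextOf hD hB hL, hofExt⟩⟩

/-- **Calibration stub B (registered `stub_calibrationNoTypeI`, LANDED p121573).** `NoTypeIBlowup` (stmt-1217) ⟹ D;
granted K1 ∧ K2, D ⟺ `NoTypeIBlowup`; K1 → K2 → D → `NoTypeII` → `NoBlowup`. -/
theorem stub_calibrationNoTypeI :
    (Summit.NavierStokesRegularity.NavierStokesRegularity.Theses.TypeICertificateLadder.NoTypeIBlowup →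
      Summit.NavierStokesRegularity.NavierStokesRegularity.Theses.IsobarTomography.TubeAlternative) ∧
    (Summit.NavierStokesRegularity.NavierStokesRegularity.Theses.IsobarTomography.BlobRiccatiClosure →
      Summit.NavierStokesRegularity.NavierStokesRegularity.Theses.IsobarTomography.IsobaricLinesLiouville →
      (Summit.NavierStokesRegularity.NavierStokesRegularity.Theses.IsobarTomography.TubeAlternative ↔
        Summit.NavierStokesRegularity.NavierStokesRegularity.Theses.TypeICertificateLadder.NoTypeIBlowup)) ∧
    (Summit.NavierStokesRegularity.NavierStokesRegularity.Theses.IsobarTomography.BlobRiccatiClosure →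
      Summit.NavierStokesRegularity.NavierStokesRegularity.Theses.IsobarTomography.IsobaricLinesLiouville →
      Summit.NavierStokesRegularity.NavierStokesRegularity.Theses.IsobarTomography.TubeAlternative →
      Summit.NavierStokesRegularity.NavierStokesRegularity.Theses.IsobarTomography.NoTypeII →
      Summit.NavierStokesRegularity.NavierStokesRegularity.Theses.IsobarTomography.NoBlowup) :=
  by
  -- Type-I extension (= `NoTypeIBlowup`, stmt-1217) ⟹ D: the antecedent of D is void
  have hofExt : Summit.NavierStokesRegularity.NavierStokesRegularity.Theses.TypeICertificateLadder.NoTypeIBlowup →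
      TubeAlternative := fun hext ν T hν hT u p hmax hLH hdec hI _ =>
    absurd (hext ν T hν hT u p hmax.1 hLH hdec hI) hmax.2
  obtain ⟨-, -, -, hiff⟩ := stub_calibrationTools
  refine ⟨hofExt, hiff, fun hB hL hD hII => ?_⟩
  intro ν T hν hT u p hcl hLH hdec
  by_contra hext
  exact hext ((hiff hB hL).1 hD ν T hν hT u p hcl hLH hdec (hII ν T hν hT u p ⟨hcl, hext⟩ hLH hdec))

/-- **What the open stub 5b costs (lead c1):** it is implied by `NoTypeIBlowup` (stmt-1217) — the Type-I
exclusion crux of route `TypeICertificateLadder`. Recorded so that the one `sorry` of this skeleton is read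
as "5b ⟸ stmt-1217" (tree: `Theorems.TubeAlternative.peakActionDecayOfAntiBlobPeaks_of_typeIExtends`). -/
theorem stub_peakActionDecayOfAntiBlobPeaks_of_noTypeIBlowup
    (hX : Summit.NavierStokesRegularity.NavierStokesRegularity.Theses.TypeICertificateLadder.NoTypeIBlowup) :
    ∀ (ν T : ℝ), 0 < ν → 0 < T → ∀ (u : ℝ → E3 → E3) (p : ℝ → E3 → ℝ),
    IsMaximalSmoothSolution ν 0 u p T → IsLerayHopfOn T ν 0 (u 0) u →
    HasRapidSpatialDecay (u 0) → IsTypeIBlowup u T →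
    (∀ κ θ : ℝ, 0 < κ → 0 < θ → θ < 1 → ∀ t₀ ∈ Set.Ico 0 T, ∃ t ∈ Set.Ico t₀ T, ∃ x : E3,
      0 < ‖curl (u t) x‖ ∧ (∀ y : E3, θ * ‖curl (u t) y‖ ≤ ‖curl (u t) x‖) ∧
      iteratedFDeriv ℝ 2 (p t) x ![curl (u t) x, curl (u t) x] <
        κ * ‖curl (u t) x‖ ^ 2 * Laplacian.laplacian (p t) x) →
    ∀ η θ : ℝ, 0 < η → 0 < θ → θ < 1 → ∀ t₁ ∈ Set.Ico 0 T, ∃ t ∈ Set.Ico t₁ T, ∃ x : E3,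
      0 < ‖curl (u t) x‖ ∧ (∀ y : E3, θ * ‖curl (u t) y‖ ≤ ‖curl (u t) x‖) ∧
      ν⁻¹ ^ 2 * (∫ z in (Set.Ioo (t - 1 / ‖curl (u t) x‖) t) ×ˢ
          Metric.ball x (Real.sqrt (ν / ‖curl (u t) x‖)),
          |⟪curl (u z.1) z.2, gradient (p z.1) z.2⟫|) < η := by
  intro ν T hν hT u p hmax hLH hdec hI _ _ _ _ _ _ _ _
  exact absurd (hX ν T hν hT u p hmax.1 hLH hdec hI) hmax.2

/-! ## Glue (sorry-free) -/

/-- The identity theorem on the preconnected open slab: an analytic function on `(-∞,0) × ℝ³`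
vanishing on a non-empty open subset vanishes on the slab. -/
theorem eqOn_zero_of_open_patch {F : ℝ × E3 → ℝ}
    (hA : AnalyticOnNhd ℝ F (Set.Iio 0 ×ˢ Set.univ))
    {U : Set (ℝ × E3)} (hUo : IsOpen U) (hUne : U.Nonempty) (hUS : U ⊆ Set.Iio 0 ×ˢ Set.univ)
    (hU0 : ∀ z ∈ U, F z = 0) : ∀ z ∈ Set.Iio (0 : ℝ) ×ˢ (Set.univ : Set E3), F z = 0 := by
  obtain ⟨z₀, hz₀⟩ := hUne
  have hpre : IsPreconnected ((Set.Iio (0 : ℝ)) ×ˢ (Set.univ : Set E3)) :=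
    isPreconnected_Iio.prod isPreconnected_univ
  have hev : F =ᶠ[𝓝 z₀] 0 := by
    filter_upwards [hUo.mem_nhds hz₀] with z hz
    exact hU0 z hz
  exact hA.eqOn_zero_of_preconnected_of_eventuallyEq_zero hpre (hUS hz₀) hev

/-- The isobaric action is non-negative. -/
theorem isobaricAction_nonneg (ν : ℝ) (u : ℝ → E3 → E3) (p : ℝ → E3 → ℝ) (t : ℝ) (x : E3) :
    0 ≤ ν⁻¹ ^ 2 * ∫ z in (Set.Ioo (t - 1 / ‖curl (u t) x‖) t) ×ˢ
        Metric.ball x (Real.sqrt (ν / ‖curl (u t) x‖)),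
        |⟪curl (u z.1) z.2, gradient (p z.1) z.2⟫| :=
  mul_nonneg (by positivity) (integral_nonneg fun _ => abs_nonneg _)

/-- **Composition (the registered skeleton).** The stubs give the crux `TubeAlternative` BY NAME. From the
two-sided rate (1) and the anti-blob peaks (5a), the bet (5b, the one `sorry` of this file) gives near-max
peaks of action `< 1/(k+1)` at times `≥ T − 1/(k+1)`; the zoom (2) turns them into an Oseen-ancient KNSS
limit with classical pressure, not slice-constant, isobaric on an open patch; its velocity is analytic
(3), so is its defect (4); the identity theorem on the preconnected slab `(-∞,0) × ℝ³` spreads the patch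
to the whole slab. The same composition with 5b as an explicit hypothesis is LANDED as
`Theorems.TubeAlternative.AnalyticPropagation.stub_tubeAlternativeOfPeakActionDecay` (p119816,
`Theorems/IsobarTomographyTubeAlternativeReduction.lean`), together with the planner's original form
`tubeAlternative_of_peakActionDecay : PAD → TubeAlternative`. -/
theorem TubeAlternative_of : TubeAlternative := by
  intro ν T hν hT u p hmax hLH hdec hI hnb
  -- (1) two-sided vorticity rate
  obtain ⟨c, C, hc, t₁, ht₁, hrate⟩ := stub_twoSidedVorticityRate ν T hν hT u p hmax hLH hdec hI
  -- (5a) anti-blob peaks from the failed blob hypothesis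
  have h5a := stub_antiBlobPeaks ν T hν hT u p hmax hLH hdec hI hnb
  -- (5) near-max peaks with small action at cofinal times
  have hθ : (0 : ℝ) < 1 / 2 := by norm_num
  have hθ1 : (1 / 2 : ℝ) < 1 := by norm_num
  have hstart : ∀ k : ℕ, max t₁ (T - 1 / ((k : ℝ) + 1)) ∈ Set.Ico 0 T := fun k =>
    ⟨ht₁.1.trans (le_max_left _ _), max_lt ht₁.2 (by
      have : (0 : ℝ) < 1 / ((k : ℝ) + 1) := by positivity
      linarith)⟩
  have key : ∀ k : ℕ, ∃ t ∈ Set.Ico (max t₁ (T - 1 / ((k : ℝ) + 1))) T, ∃ x : E3,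
      0 < ‖curl (u t) x‖ ∧ (∀ y : E3, (1 / 2) * ‖curl (u t) y‖ ≤ ‖curl (u t) x‖) ∧
      ν⁻¹ ^ 2 * (∫ z in (Set.Ioo (t - 1 / ‖curl (u t) x‖) t) ×ˢ
          Metric.ball x (Real.sqrt (ν / ‖curl (u t) x‖)),
          |⟪curl (u z.1) z.2, gradient (p z.1) z.2⟫|) < 1 / ((k : ℝ) + 1) := fun k =>
    stub_peakActionDecayOfAntiBlobPeaks ν T hν hT u p hmax hLH hdec hI h5a (1 / ((k : ℝ) + 1)) (1 / 2)
      (by positivity) hθ hθ1 _ (hstart k)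
  choose tk htk xk hpos hnear hact using key
  have htk₁ : ∀ k, tk k ∈ Set.Ico t₁ T := fun k =>
    ⟨(le_max_left _ _).trans (htk k).1, (htk k).2⟩
  have htend : Tendsto tk atTop (𝓝 T) := by
    have hlow : Tendsto (fun k : ℕ => T - 1 / ((k : ℝ) + 1)) atTop (𝓝 T) := by
      have h1 : Tendsto (fun k : ℕ => 1 / ((k : ℝ) + 1)) atTop (𝓝 0) :=
        tendsto_one_div_add_atTop_nhds_zero_nat
      simpa using (tendsto_const_nhds (x := T)).sub h1
    refine tendsto_of_tendsto_of_tendsto_of_le_of_le hlow tendsto_const_nhds (fun k => ?_) (fun k => ?_)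
    · exact (le_max_right _ _).trans (htk k).1
    · exact (htk k).2.le
  have haction : Tendsto (fun k => ν⁻¹ ^ 2 *
      ∫ z in (Set.Ioo (tk k - 1 / ‖curl (u (tk k)) (xk k)‖) (tk k)) ×ˢ
        Metric.ball (xk k) (Real.sqrt (ν / ‖curl (u (tk k)) (xk k)‖)),
        |⟪curl (u z.1) z.2, gradient (p z.1) z.2⟫|) atTop (𝓝 0) := by
    have h1 : Tendsto (fun k : ℕ => 1 / ((k : ℝ) + 1)) atTop (𝓝 0) :=
      tendsto_one_div_add_atTop_nhds_zero_nat
    refine tendsto_of_tendsto_of_tendsto_of_le_of_le tendsto_const_nhds h1 (fun k => ?_) (fun k => ?_)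
    · exact isobaricAction_nonneg ν u p (tk k) (xk k)
    · exact (hact k).le
  -- (2) the zoom
  obtain ⟨v, q, hv, hcl, hos, hnc, U, hUo, hUne, hUS, hU0⟩ :=
    stub_peakZoomPatch ν T hν hT u p hmax hLH hdec hI c C t₁ hc ht₁ hrate (1 / 2) hθ hθ1 tk xk htk₁
      htend hpos hnear haction
  -- (3) analytic velocity, (4) analytic defect
  have hcont : ContinuousOn (uncurry v) (Set.Iio 0 ×ˢ Set.univ) := hcl.smooth_velocity.continuousOn
  have hbd : ∃ M : ℝ, ∀ t < 0, ∀ x : E3, ‖v t x‖ ≤ M := ⟨1, hv.norm_le_one⟩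
  have hAv := stub_oseenAncientAnalytic v hcont hbd hos
  have hAF := stub_defectAnalyticOfVelocity v q hAv hcl
  -- identity theorem
  have hzero := eqOn_zero_of_open_patch hAF hUo hUne hUS hU0
  exact ⟨v, q, hv, hcl, fun t ht x => hzero (t, x) ⟨ht, Set.mem_univ _⟩, hnc⟩

end Summit.NavierStokesRegularity.NavierStokesRegularity.Cruxes.TubeAlternative.AnalyticPropagation

end
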